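import Literature.NumberTheory.Automorphic.UnitaryGroupTraceZeroLattice
import HarnessLib

/-!
# A fundamental domain for `N(F)` in the Heisenberg group `N(𝔸_F)` of `U(3)`

Topic `NumberTheory/Automorphic`; namespace `Literature.NumberTheory.Automorphic.UnitaryGroup`.
DEFINITIONS with bodies + proved lemmas; no named fact, no `sorry`, no instance, no notation.
Setting: Rogawski's `U(3) = U(J₃)` over a quadratic `E/F` with involution `c` (`c * c = 1`),
`N(𝔸_F) = adelicUnipotent F E c 3` the unipotent radical of its Borel subgroup, `N(F) = rationalUnipotent`
its rational points, and the Heisenberg chart `heisHomeomorph` (`UnitaryGroupHeisenberg`), which lives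
on the copy `unipotentInBorel F E c 3` of `N(𝔸_F)` inside `B(𝔸_F)`.

* `unipToBorel : N(𝔸_F) ≃* unipotentInBorel` (the tautological isomorphism, a homeomorphism) and the
  chart **`heisChart hc : 𝔸_E × 𝔸_E⁻ ≃ₜ N(𝔸_F)`** on the tree's `adelicUnipotent`, with the coordinate
  maps `coordX`, `coordY` and the group law / left-translation formulas transported;
* **rational elements**: `ratHeis hc x₀ y₀ ∈ N(F)` for `x₀ ∈ E`, `y₀ ∈ E⁻` (an explicit element of
  `U(J₃)(E)`, `toAdelic` of which is `heisChart (x₀, y₀)`), and conversely the coordinates of an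
  element of `N(F)` are principal (`coordX_mem_range_of_mem`, `coordY_mem_rationalTraceZero_of_mem`);
* **`heisFundamentalDomain hc = heisChart '' (D_E ×ˢ 𝓕⁻)`** is a measurable fundamental domain for the
  left translation action of `N(F)` on `N(𝔸_F)`, for every measure
  (`isFundamentalDomain_heisFundamentalDomain`): given `u = u(x, y)` there is a unique `x₀ ∈ E` with
  `x₀ + x ∈ D_E` (Tate) and then a unique `y₀ ∈ E⁻` with `y₀ + y + ½(x c x₀ − x₀ c x) ∈ 𝓕⁻`
  (`UnitaryGroupTraceZeroLattice`); it is contained in a compact set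
  (`exists_isCompact_heisFundamentalDomain_subset`).

Rogawski (1990), §1.10, §2.1 (`N(F)\N(𝔸)` and the constant term along `B`); Tate, Thm. 4.1.3.

## References

* J. D. Rogawski, *Automorphic Representations of Unitary Groups in Three Variables* (1990), §1.10,
  §2.1 [Rogawski1990].
* J. Tate, *Fourier analysis in number fields and Hecke's zeta-functions* (1967), Thm. 4.1.3
  [CasselsFrohlichANT1967].
-/

noncomputable section

open Matrix NumberField IsDedekindDomain Topology MeasureTheory Measure
open scoped MatrixGroups Pointwise

namespace Literature.NumberTheory.Automorphic

namespace UnitaryGroup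

variable {F E : Type} [Field F] [NumberField F] [Field E] [NumberField E] [Algebra F E]
  {c : E ≃ₐ[F] E}

/-! ## §1 `N(𝔸_F)` and its copy inside `B(𝔸_F)`; the chart on `adelicUnipotent` -/

variable (F E c) in
/-- The tautological isomorphism `N(𝔸_F) ≃* unipotentInBorel` (the same adelic points, viewed inside
`B(𝔸_F)`). [cite: Rogawski1990, §1.10] -/
def unipToBorel : adelicUnipotent F E c 3 ≃* unipotentInBorel F E c 3 where
  toFun u := ⟨⟨(u : (quasiSplit F E c 3).Adelic), adelicUnipotent_le_borelAdelic u.2⟩, u.2⟩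
  invFun v := ⟨((v : borelAdelic F E c 3) : (quasiSplit F E c 3).Adelic), v.2⟩
  left_inv _ := rfl
  right_inv _ := rfl
  map_mul' _ _ := rfl

/-- `unipToBorel` on underlying adelic points (definitional). [cite: Rogawski1990, §1.10] -/
@[simp] theorem coe_coe_unipToBorel (u : adelicUnipotent F E c 3) :
    (((unipToBorel F E c u : unipotentInBorel F E c 3) : borelAdelic F E c 3) : (quasiSplit F E c 3).Adelic) = u := rfl

/-- `unipToBorel.symm` on underlying adelic points (definitional). [cite: Rogawski1990, §1.10] -/
@[simp] theorem coe_unipToBorel_symm (v : unipotentInBorel F E c 3) :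
    (((unipToBorel F E c).symm v : adelicUnipotent F E c 3) : (quasiSplit F E c 3).Adelic) =
      ((v : borelAdelic F E c 3) : (quasiSplit F E c 3).Adelic) := rfl

/-- `unipToBorel` is continuous. [cite: Rogawski1990, §1.10] -/
theorem continuous_unipToBorel : Continuous (unipToBorel F E c) :=
  (continuous_subtype_val.subtype_mk _).subtype_mk _

/-- `unipToBorel.symm` is continuous. [cite: Rogawski1990, §1.10] -/
theorem continuous_unipToBorel_symm : Continuous (unipToBorel F E c).symm :=
  (continuous_subtype_val.comp continuous_subtype_val).subtype_mk _

variable (F E c) in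
/-- `unipToBorel` as an isomorphism of topological groups. [cite: Rogawski1990, §1.10] -/
def unipToBorelₜ : adelicUnipotent F E c 3 ≃ₜ* unipotentInBorel F E c 3 :=
  { unipToBorel F E c with
    continuous_toFun := continuous_unipToBorel
    continuous_invFun := continuous_unipToBorel_symm }

/-- **The Heisenberg chart on the tree's `N(𝔸_F) = adelicUnipotent F E c 3`**:
`(x, y) ↦ u(x, y − ½ x c(x))`. [cite: Rogawski1990, §1.10] -/
def heisChart (hc : c * c = 1) : AdeleRing (𝓞 E) E × traceZeroAdele F E c ≃ₜ adelicUnipotent F E c 3 :=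
  (heisHomeomorph hc).trans (unipToBorelₜ F E c).symm.toHomeomorph

/-- The first coordinate `x(u) = u₀₁` on `N(𝔸_F)`. [cite: Rogawski1990, §1.10] -/
def coordX (u : adelicUnipotent F E c 3) : AdeleRing (𝓞 E) E := heisX (unipToBorel F E c u)

/-- The second coordinate `y(u) = u₀₂ + ½ u₀₁ c(u₀₁) ∈ 𝔸_E⁻` on `N(𝔸_F)`. [cite: Rogawski1990, §1.10] -/
def coordY (hc : c * c = 1) (u : adelicUnipotent F E c 3) : traceZeroAdele F E c := heisY hc (unipToBorel F E c u)

/-- `heisChart hc (x, y)` is `heisElt hc x y` as an adelic point. [cite: Rogawski1990, §1.10] -/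
theorem coe_heisChart (hc : c * c = 1) (p : AdeleRing (𝓞 E) E × traceZeroAdele F E c) :
    ((heisChart hc p : adelicUnipotent F E c 3) : (quasiSplit F E c 3).Adelic) =
      (((heisElt hc p.1 p.2 : unipotentInBorel F E c 3) : borelAdelic F E c 3) : (quasiSplit F E c 3).Adelic) := rfl

/-- `unipToBorel (heisChart hc p) = heisElt hc p.1 p.2`. [cite: Rogawski1990, §1.10] -/
@[simp] theorem unipToBorel_heisChart (hc : c * c = 1) (p : AdeleRing (𝓞 E) E × traceZeroAdele F E c) :
    unipToBorel F E c (heisChart hc p) = heisElt hc p.1 p.2 := rfl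

/-- `(heisChart hc).symm u = (coordX u, coordY hc u)`. [cite: Rogawski1990, §1.10] -/
@[simp] theorem heisChart_symm_apply (hc : c * c = 1) (u : adelicUnipotent F E c 3) :
    (heisChart hc).symm u = (coordX u, coordY hc u) := rfl

/-- `coordX (heisChart (x, y)) = x`. [cite: Rogawski1990, §1.10] -/
@[simp] theorem coordX_heisChart (hc : c * c = 1) (p : AdeleRing (𝓞 E) E × traceZeroAdele F E c) :
    coordX (heisChart hc p) = p.1 := heisX_heisElt hc p.1 p.2

/-- `coordY (heisChart (x, y)) = y`. [cite: Rogawski1990, §1.10] -/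
@[simp] theorem coordY_heisChart (hc : c * c = 1) (p : AdeleRing (𝓞 E) E × traceZeroAdele F E c) :
    coordY hc (heisChart hc p) = p.2 := heisY_heisElt hc p.1 p.2

/-- `heisChart (coordX u, coordY u) = u`. [cite: Rogawski1990, §1.10] -/
@[simp] theorem heisChart_coord (hc : c * c = 1) (u : adelicUnipotent F E c 3) :
    heisChart hc (coordX u, coordY hc u) = u := (heisChart hc).apply_symm_apply u

/-- **Left translation in the chart**: `u₀ · u(x, y) = u(x(u₀) + x, y + (y(u₀) + ½ (x c(x(u₀)) − x(u₀) c(x))))`,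
coordinate `x`. [cite: Rogawski1990, §1.10] -/
theorem coordX_mul_heisChart (hc : c * c = 1) (u₀ : adelicUnipotent F E c 3)
    (p : AdeleRing (𝓞 E) E × traceZeroAdele F E c) : coordX (u₀ * heisChart hc p) = coordX u₀ + p.1 := by
  change heisX (unipToBorel F E c u₀ * heisElt hc p.1 p.2) = _
  exact heisX_mul_heisElt hc _ p.1 p.2

/-- Left translation in the chart, coordinate `y`. [cite: Rogawski1990, §1.10] -/
theorem coe_coordY_mul_heisChart (hc : c * c = 1) (u₀ : adelicUnipotent F E c 3)
    (p : AdeleRing (𝓞 E) E × traceZeroAdele F E c) :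
    (coordY hc (u₀ * heisChart hc p) : AdeleRing (𝓞 E) E) = (p.2 : AdeleRing (𝓞 E) E) +
      ((coordY hc u₀ : AdeleRing (𝓞 E) E) +
        halfAdele * (p.1 * conjAdele F E c (coordX u₀) - coordX u₀ * conjAdele F E c p.1)) := by
  change (heisY hc (unipToBorel F E c u₀ * heisElt hc p.1 p.2) : AdeleRing (𝓞 E) E) = _
  exact coe_heisY_mul_heisElt hc _ p.1 p.2

/-! ## §2 Rational Heisenberg elements -/

section Rational

/-- `½ ∈ E`-version of the `z`-entry: `z₀ = y₀ − ½ x₀ c(x₀)`. [cite: Rogawski1990, §1.10] -/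
def ratZ (x₀ y₀ : E) : E := y₀ - 2⁻¹ * (x₀ * c x₀)

omit [NumberField F] in
/-- `algebraMap` of `ratZ` is `heisZ` of the principal adeles. [cite: Rogawski1990, §1.10] -/
theorem algebraMap_ratZ (x₀ y₀ : E) :
    algebraMap E (AdeleRing (𝓞 E) E) (ratZ (c := c) x₀ y₀) =
      heisZ (c := c) (algebraMap E (AdeleRing (𝓞 E) E) x₀) (algebraMap E (AdeleRing (𝓞 E) E) y₀) := by
  rw [ratZ, heisZ, map_sub, map_mul, map_mul, ← algebraMap_conj, RingHom.coe_coe, halfAdele]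

omit [NumberField F] in
/-- The relation `z₀ + c z₀ + x₀ c x₀ = 0` over `E`. [cite: Rogawski1990, §1.10] -/
theorem ratZ_add_conj (hc : c * c = 1) (x₀ : E) {y₀ : E} (hy₀ : c y₀ = -y₀) :
    ratZ (c := c) x₀ y₀ + c (ratZ (c := c) x₀ y₀) = -(x₀ * c x₀) := by
  have hcc : c (c x₀) = x₀ := by rw [← AlgEquiv.mul_apply, hc, AlgEquiv.one_apply]
  simp only [ratZ, map_sub, map_mul, map_inv₀, map_ofNat, hy₀, hcc]
  ring

/-- The rational matrix `u(x₀, z₀)` over `E`. [cite: Rogawski1990, §1.10] -/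
def ratHeisMatrix (x₀ y₀ : E) : Matrix (Fin 3) (Fin 3) E :=
  !![1, x₀, ratZ (c := c) x₀ y₀; 0, 1, -c x₀; 0, 0, 1]

/-- Its inverse `u(−x₀, c z₀)`. [cite: Rogawski1990, §1.10] -/
def ratHeisMatrixInv (x₀ y₀ : E) : Matrix (Fin 3) (Fin 3) E :=
  !![1, -x₀, c (ratZ (c := c) x₀ y₀); 0, 1, c x₀; 0, 0, 1]

omit [NumberField F] in
/-- `u(x₀, z₀) · u(−x₀, c z₀) = 1`. [folklore] -/
private theorem ratHeisMatrix_mul_inv (hc : c * c = 1) (x₀ : E) {y₀ : E} (hy₀ : c y₀ = -y₀) :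
    ratHeisMatrix (c := c) x₀ y₀ * ratHeisMatrixInv (c := c) x₀ y₀ = 1 := by
  have hrel := ratZ_add_conj hc x₀ hy₀
  ext i j
  fin_cases i <;> fin_cases j <;> simp [ratHeisMatrix, ratHeisMatrixInv, Matrix.mul_apply, Fin.sum_univ_three]
  all_goals linear_combination hrel

omit [NumberField F] in
/-- `u(−x₀, c z₀) · u(x₀, z₀) = 1`. [folklore] -/
private theorem ratHeisMatrixInv_mul (hc : c * c = 1) (x₀ : E) {y₀ : E} (hy₀ : c y₀ = -y₀) :
    ratHeisMatrixInv (c := c) x₀ y₀ * ratHeisMatrix (c := c) x₀ y₀ = 1 := by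
  have hrel := ratZ_add_conj hc x₀ hy₀
  ext i j
  fin_cases i <;> fin_cases j <;> simp [ratHeisMatrix, ratHeisMatrixInv, Matrix.mul_apply, Fin.sum_univ_three]
  all_goals linear_combination hrel

/-- **The rational Heisenberg element `u(x₀, z₀) ∈ U(J₃)(E)`** for `x₀ ∈ E`, `y₀ ∈ E⁻`.
[cite: Rogawski1990, §1.10] -/
def ratHeis (hc : c * c = 1) (x₀ : E) {y₀ : E} (hy₀ : c y₀ = -y₀) :
    rational F E c 3 ((StdForm.antidiagonal 3).over E) :=
  ⟨⟨ratHeisMatrix (c := c) x₀ y₀, ratHeisMatrixInv (c := c) x₀ y₀, ratHeisMatrix_mul_inv hc x₀ hy₀,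
      ratHeisMatrixInv_mul hc x₀ hy₀⟩, by
    have hrel := ratZ_add_conj hc x₀ hy₀
    have hcc : ∀ x : E, c (c x) = x := fun x => by rw [← AlgEquiv.mul_apply, hc, AlgEquiv.one_apply]
    change _ ∈ unitaryGroupOfForm (c : E →+* E) ((StdForm.antidiagonal 3).over E)
    rw [mem_unitaryGroupOfForm_antidiagonal_iff_sum']
    have r0 : (0 : Fin 3).rev = 2 := rfl
    have r1 : (1 : Fin 3).rev = 1 := rfl
    have r2 : (2 : Fin 3).rev = 0 := rfl
    intro a b
    fin_cases a <;> fin_cases b <;>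
      simp [ratHeisMatrix, Fin.sum_univ_three, r0, r1, r2, hcc, map_neg]
    all_goals linear_combination hrel⟩

/-- **`toAdelic (ratHeis x₀ y₀) = heisChart (x₀, y₀)`** (as adelic points): the rational Heisenberg
element is the chart point with principal coordinates. [cite: Rogawski1990, §1.10] -/
theorem toAdelic_ratHeis (hc : c * c = 1) (x₀ : E) {y₀ : E} (hy₀ : c y₀ = -y₀) :
    ((quasiSplit F E c 3).toAdelic (ratHeis hc x₀ hy₀) : (quasiSplit F E c 3).Adelic) =
      ((heisChart hc (algebraMap E (AdeleRing (𝓞 E) E) x₀,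
        ⟨algebraMap E (AdeleRing (𝓞 E) E) y₀, algebraMap_mem_traceZeroAdele hy₀⟩) : adelicUnipotent F E c 3) :
        (quasiSplit F E c 3).Adelic) := by
  refine adelicVal_injective F E c 3 _ (Matrix.GeneralLinearGroup.ext fun i j => ?_)
  change algebraMap E (AdeleRing (𝓞 E) E) (ratHeisMatrix (c := c) x₀ y₀ i j) =
    heisMatrix (c := c) (algebraMap E (AdeleRing (𝓞 E) E) x₀) (algebraMap E (AdeleRing (𝓞 E) E) y₀) i j
  fin_cases i <;> fin_cases j <;>
    simp [ratHeisMatrix, heisMatrix, algebraMap_ratZ, ← algebraMap_conj, map_neg, -conjAdele_apply]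

/-- The rational Heisenberg element as an element of `N(F) ≤ N(𝔸_F)`. [cite: Rogawski1990, §1.10] -/
def ratHeisElt (hc : c * c = 1) (x₀ : E) {y₀ : E} (hy₀ : c y₀ = -y₀) : rationalUnipotent F E c 3 :=
  ⟨heisChart hc (algebraMap E (AdeleRing (𝓞 E) E) x₀,
      ⟨algebraMap E (AdeleRing (𝓞 E) E) y₀, algebraMap_mem_traceZeroAdele hy₀⟩),
    (mem_rationalUnipotent_iff _).2 ⟨ratHeis hc x₀ hy₀, toAdelic_ratHeis hc x₀ hy₀⟩⟩

/-- `coordX` of the rational element is the principal adele `x₀`. [cite: Rogawski1990, §1.10] -/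
@[simp] theorem coordX_ratHeisElt (hc : c * c = 1) (x₀ : E) {y₀ : E} (hy₀ : c y₀ = -y₀) :
    coordX ((ratHeisElt hc x₀ hy₀ : rationalUnipotent F E c 3) : adelicUnipotent F E c 3) =
      algebraMap E (AdeleRing (𝓞 E) E) x₀ :=
  coordX_heisChart hc _

/-- `coordY` of the rational element is the principal adele `y₀`. [cite: Rogawski1990, §1.10] -/
@[simp] theorem coe_coordY_ratHeisElt (hc : c * c = 1) (x₀ : E) {y₀ : E} (hy₀ : c y₀ = -y₀) :
    ((coordY hc ((ratHeisElt hc x₀ hy₀ : rationalUnipotent F E c 3) : adelicUnipotent F E c 3) :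
      traceZeroAdele F E c) : AdeleRing (𝓞 E) E) = algebraMap E (AdeleRing (𝓞 E) E) y₀ := by
  have := coordY_heisChart hc (algebraMap E (AdeleRing (𝓞 E) E) x₀,
    (⟨algebraMap E (AdeleRing (𝓞 E) E) y₀, algebraMap_mem_traceZeroAdele hy₀⟩ : traceZeroAdele F E c))
  exact congrArg Subtype.val this

/-- **The coordinates of a rational element are principal**: `x(γ) ∈ E` for `γ ∈ N(F)`.
[cite: Rogawski1990, §1.10] -/
theorem coordX_mem_range_of_mem {γ : adelicUnipotent F E c 3} (hγ : γ ∈ rationalUnipotent F E c 3) :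
    ∃ ξ : E, algebraMap E (AdeleRing (𝓞 E) E) ξ = coordX γ := by
  obtain ⟨g, hg⟩ := (mem_rationalUnipotent_iff γ).1 hγ
  exact ⟨((g : GL (Fin 3) E) : Matrix (Fin 3) (Fin 3) E) 0 1, (adelicVal_apply_eq_algebraMap hg 0 1).symm⟩

/-- `y(γ) ∈ E⁻` for `γ ∈ N(F)`. [cite: Rogawski1990, §1.10] -/
theorem coordY_mem_rationalTraceZero_of_mem (hc : c * c = 1) {γ : adelicUnipotent F E c 3}
    (hγ : γ ∈ rationalUnipotent F E c 3) : coordY hc γ ∈ rationalTraceZero F E c := by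
  obtain ⟨g, hg⟩ := (mem_rationalUnipotent_iff γ).1 hγ
  rw [mem_rationalTraceZero_iff]
  refine ⟨((g : GL (Fin 3) E) : Matrix (Fin 3) (Fin 3) E) 0 2 +
    2⁻¹ * (((g : GL (Fin 3) E) : Matrix (Fin 3) (Fin 3) E) 0 1 * c (((g : GL (Fin 3) E) : Matrix (Fin 3) (Fin 3) E) 0 1)), ?_⟩
  change _ = (heisY hc (unipToBorel F E c γ) : AdeleRing (𝓞 E) E)
  rw [coe_heisY, heisX_def]
  change _ = (adelicVal F E c 3 _ (γ : (quasiSplit F E c 3).Adelic) : Matrix (Fin 3) (Fin 3) _) 0 2 +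
    halfAdele * ((adelicVal F E c 3 _ (γ : (quasiSplit F E c 3).Adelic) : Matrix (Fin 3) (Fin 3) _) 0 1 *
      conjAdele F E c ((adelicVal F E c 3 _ (γ : (quasiSplit F E c 3).Adelic) : Matrix (Fin 3) (Fin 3) _) 0 1))
  rw [adelicVal_apply_eq_algebraMap hg 0 2, adelicVal_apply_eq_algebraMap hg 0 1, map_add, map_mul, map_mul,
    ← algebraMap_conj, RingHom.coe_coe, halfAdele]

end Rational

/-! ## §3 The fundamental domain `heisChart(D_E × 𝓕⁻)` for `N(F)` in `N(𝔸_F)` -/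

section FundamentalDomain

omit [NumberField F] in
/-- The shift `½(x c(a) − a c(x))` is trace-zero, so `y + ½(x c(a) − a c(x)) ∈ 𝔸_E⁻` for `y ∈ 𝔸_E⁻`. [folklore] -/
private theorem shift_mem (hc : c * c = 1) (a x : AdeleRing (𝓞 E) E) (y : traceZeroAdele F E c) :
    (y : AdeleRing (𝓞 E) E) + halfAdele * (x * conjAdele F E c a - a * conjAdele F E c x) ∈ traceZeroAdele F E c := by
  have hy := (mem_traceZeroAdele_iff _).1 y.2
  have hh : conjAdele F E c (halfAdele : AdeleRing (𝓞 E) E) = halfAdele := by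
    rw [halfAdele, ← algebraMap_conj]; congr 1; rw [RingHom.coe_coe, map_inv₀, map_ofNat]
  rw [mem_traceZeroAdele_iff, map_add, hy, map_mul, hh, map_sub, map_mul, map_mul,
    conjAdele_conjAdele hc, conjAdele_conjAdele hc]
  ring

/-- The shifted second coordinate `y(u) + ½(x(u) c(a) − a c(x(u)))` (the `y`-coordinate of
`u(a, 0) · u` ). [folklore] -/
private def shiftY (hc : c * c = 1) (a : AdeleRing (𝓞 E) E) (u : adelicUnipotent F E c 3) : traceZeroAdele F E c :=
  ⟨(coordY hc u : AdeleRing (𝓞 E) E) + halfAdele * (coordX u * conjAdele F E c a - a * conjAdele F E c (coordX u)),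
    shift_mem hc a (coordX u) (coordY hc u)⟩

/-- **Coordinates of `γ · u` for a rational `γ = u(x₀, y₀)`**: `x(γ u) = x₀ + x(u)`.
[cite: Rogawski1990, §1.10] -/
theorem coordX_ratHeisElt_smul (hc : c * c = 1) (x₀ : E) {y₀ : E} (hy₀ : c y₀ = -y₀) (u : adelicUnipotent F E c 3) :
    coordX ((ratHeisElt hc x₀ hy₀ : rationalUnipotent F E c 3) • u) =
      algebraMap E (AdeleRing (𝓞 E) E) x₀ + coordX u := by
  rw [Subgroup.smul_def, smul_eq_mul]
  conv_lhs => rw [← heisChart_coord hc u]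
  rw [coordX_mul_heisChart, coordX_ratHeisElt]

/-- `y(γ u) = y₀ + (y(u) + ½(x(u) c x₀ − x₀ c x(u)))` for `γ = u(x₀, y₀)` rational. [cite: Rogawski1990, §1.10] -/
theorem coe_coordY_ratHeisElt_smul (hc : c * c = 1) (x₀ : E) {y₀ : E} (hy₀ : c y₀ = -y₀) (u : adelicUnipotent F E c 3) :
    (coordY hc ((ratHeisElt hc x₀ hy₀ : rationalUnipotent F E c 3) • u) : AdeleRing (𝓞 E) E) =
      algebraMap E (AdeleRing (𝓞 E) E) y₀ + (shiftY hc (algebraMap E (AdeleRing (𝓞 E) E) x₀) u : AdeleRing (𝓞 E) E) := by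
  rw [Subgroup.smul_def, smul_eq_mul]
  conv_lhs => rw [← heisChart_coord hc u]
  rw [coe_coordY_mul_heisChart, coe_coordY_ratHeisElt, coordX_ratHeisElt]
  change _ = _ + ((coordY hc u : AdeleRing (𝓞 E) E) + _)
  ring

/-- Every element of `N(F)` is a rational Heisenberg element `u(x₀, y₀)`. [cite: Rogawski1990, §1.10] -/
theorem exists_eq_ratHeisElt (hc : c * c = 1) (γ : rationalUnipotent F E c 3) :
    ∃ (x₀ y₀ : E) (hy₀ : c y₀ = -y₀), γ = ratHeisElt hc x₀ hy₀ := by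
  haveI : Nontrivial (AdeleRing (𝓞 E) E) :=
    inferInstanceAs (Nontrivial (InfiniteAdeleRing E × FiniteAdeleRing (𝓞 E) E))
  obtain ⟨ξ, hξ⟩ := coordX_mem_range_of_mem (F := F) (E := E) (c := c) γ.2
  obtain ⟨η, hη⟩ := (mem_rationalTraceZero_iff _).1 (coordY_mem_rationalTraceZero_of_mem hc γ.2)
  have hηc : c η = -η := by
    have h := (mem_traceZeroAdele_iff _).1 (coordY hc (γ : adelicUnipotent F E c 3)).2
    rw [← hη, ← algebraMap_conj, RingHom.coe_coe, ← map_neg] at h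
    exact (algebraMap E (AdeleRing (𝓞 E) E)).injective h
  refine ⟨ξ, η, hηc, Subtype.ext ?_⟩
  change (γ : adelicUnipotent F E c 3) = heisChart hc _
  rw [← heisChart_coord hc (γ : adelicUnipotent F E c 3)]
  congr 1
  exact Prod.ext hξ.symm (Subtype.ext hη.symm)

variable (F E c) in
/-- **The fundamental domain `𝓕_N = heisChart(D_E × 𝓕⁻)`** for `N(F)` acting on `N(𝔸_F)` by left
translation. [cite: Rogawski1990, §2.1] -/
def heisFundamentalDomain (hc : c * c = 1) : Set (adelicUnipotent F E c 3) :=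
  heisChart hc '' (adeleFundamentalDomain E ×ˢ traceZeroFundamentalDomain F E c)

/-- Membership in `𝓕_N` in coordinates. [cite: Rogawski1990, §2.1] -/
theorem mem_heisFundamentalDomain_iff (hc : c * c = 1) (u : adelicUnipotent F E c 3) :
    u ∈ heisFundamentalDomain F E c hc ↔
      coordX u ∈ adeleFundamentalDomain E ∧ coordY hc u ∈ traceZeroFundamentalDomain F E c := by
  constructor
  · rintro ⟨p, ⟨hp1, hp2⟩, rfl⟩
    exact ⟨by rwa [coordX_heisChart], by rwa [coordY_heisChart]⟩
  · rintro ⟨h1, h2⟩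
    exact ⟨(coordX u, coordY hc u), ⟨h1, h2⟩, heisChart_coord hc u⟩

/-- **Unique representability**: every `u ∈ N(𝔸_F)` has exactly one left `N(F)`-translate in `𝓕_N`
(unique `x₀` by Tate's theorem for `E ⊂ 𝔸_E`, then unique `y₀` by the one for `E⁻ ⊂ 𝔸_E⁻`).
[cite: Rogawski1990, §2.1] -/
theorem existsUnique_smul_mem_heisFundamentalDomain (hc : c * c = 1) (u : adelicUnipotent F E c 3) :
    ∃! γ : rationalUnipotent F E c 3, γ • u ∈ heisFundamentalDomain F E c hc := by
  haveI : Nontrivial (AdeleRing (𝓞 E) E) :=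
    inferInstanceAs (Nontrivial (InfiniteAdeleRing E × FiniteAdeleRing (𝓞 E) E))
  obtain ⟨ξ, hξ, hξuniq⟩ := existsUnique_add_algebraMap_mem_adeleFundamentalDomain E (coordX u)
  set s : traceZeroAdele F E c := shiftY hc (algebraMap E (AdeleRing (𝓞 E) E) ξ) u with hs
  obtain ⟨g, hg, hguniq⟩ := existsUnique_vadd_mem_traceZeroFundamentalDomain hc s
  obtain ⟨η, hη⟩ := (mem_rationalTraceZero_iff _).1 g.2
  have hηc : c η = -η := by
    have h := (mem_traceZeroAdele_iff _).1 (g : traceZeroAdele F E c).2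
    rw [← hη, ← algebraMap_conj, RingHom.coe_coe, ← map_neg] at h
    exact (algebraMap E (AdeleRing (𝓞 E) E)).injective h
  have hgs : ((g +ᵥ s : traceZeroAdele F E c) : AdeleRing (𝓞 E) E) = algebraMap E (AdeleRing (𝓞 E) E) η + s := by
    change ((g : traceZeroAdele F E c) : AdeleRing (𝓞 E) E) + (s : AdeleRing (𝓞 E) E) = _
    rw [← hη]
  refine ⟨ratHeisElt hc ξ hηc, ?_, ?_⟩
  · show (ratHeisElt hc ξ hηc : rationalUnipotent F E c 3) • u ∈ heisFundamentalDomain F E c hc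
    rw [mem_heisFundamentalDomain_iff, coordX_ratHeisElt_smul]
    refine ⟨hξ, ?_⟩
    have heq : coordY hc ((ratHeisElt hc ξ hηc : rationalUnipotent F E c 3) • u) = g +ᵥ s :=
      Subtype.ext (by rw [coe_coordY_ratHeisElt_smul, hgs])
    rw [heq]; exact hg
  · intro γ' hγ'
    change γ' • u ∈ heisFundamentalDomain F E c hc at hγ'
    obtain ⟨ξ', η', hη'c, rfl⟩ := exists_eq_ratHeisElt hc γ'
    rw [mem_heisFundamentalDomain_iff, coordX_ratHeisElt_smul] at hγ'
    have hξ' : ξ' = ξ := hξuniq ξ' hγ'.1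
    subst hξ'
    -- the `y`-coordinate: `η' + s ∈ 𝓕⁻` forces `η' = η`
    set g' : rationalTraceZero F E c :=
      ⟨⟨algebraMap E (AdeleRing (𝓞 E) E) η', algebraMap_mem_traceZeroAdele hη'c⟩, η', rfl⟩ with hg'
    have hg's : g' +ᵥ s ∈ traceZeroFundamentalDomain F E c := by
      have heq : (g' +ᵥ s : traceZeroAdele F E c) = coordY hc ((ratHeisElt hc ξ' hη'c : rationalUnipotent F E c 3) • u) :=
        Subtype.ext (by rw [coe_coordY_ratHeisElt_smul]; rfl)
      rw [heq]; exact hγ'.2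
    have hgg : g' = g := hguniq g' hg's
    have hηη : η' = η := by
      have := congrArg (fun z : rationalTraceZero F E c => ((z : traceZeroAdele F E c) : AdeleRing (𝓞 E) E)) hgg
      change algebraMap E (AdeleRing (𝓞 E) E) η' = ((g : traceZeroAdele F E c) : AdeleRing (𝓞 E) E) at this
      rw [← hη] at this
      exact (algebraMap E (AdeleRing (𝓞 E) E)).injective this
    subst hηη
    rfl

/-- `𝓕_N` is contained in a compact set (`heisChart(closure D_E × (closure D_E)⁻)`). [cite: Rogawski1990, §2.1] -/
theorem exists_isCompact_heisFundamentalDomain_subset (hc : c * c = 1) :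
    ∃ C : Set (adelicUnipotent F E c 3), IsCompact C ∧ heisFundamentalDomain F E c hc ⊆ C := by
  obtain ⟨K, hK, hsub⟩ := exists_isCompact_traceZeroFundamentalDomain_subset (F := F) (E := E) (c := c) hc
  refine ⟨heisChart hc '' (closure (adeleFundamentalDomain E) ×ˢ K),
    ((isCompact_closure_adeleFundamentalDomain E).prod hK).image (heisChart hc).continuous, ?_⟩
  exact Set.image_mono (Set.prod_mono subset_closure hsub)

section Measure

variable [MeasurableSpace (AdeleRing (𝓞 E) E)] [BorelSpace (AdeleRing (𝓞 E) E)]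
  [MeasurableSpace (adelicUnipotent F E c 3)] [BorelSpace (adelicUnipotent F E c 3)]

/-- `𝓕_N` is a Borel set (image of a Borel set under the homeomorphism `heisChart`). [cite: Rogawski1990, §2.1] -/
theorem measurableSet_heisFundamentalDomain (hc : c * c = 1) : MeasurableSet (heisFundamentalDomain F E c hc) := by
  haveI := secondCountableTopology_adeleRing E
  haveI : SecondCountableTopology (traceZeroAdele F E c) := TopologicalSpace.Subtype.secondCountableTopology _
  have e : heisFundamentalDomain F E c hc =
      (heisChart hc).toMeasurableEquiv '' (adeleFundamentalDomain E ×ˢ traceZeroFundamentalDomain F E c) := rfl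
  rw [e, MeasurableEquiv.measurableSet_image]
  exact (measurableSet_adeleFundamentalDomain E).prod measurableSet_traceZeroFundamentalDomain

/-- **`𝓕_N` is a measurable fundamental domain for the left translation action of `N(F)` on `N(𝔸_F)`**,
for every measure. [cite: Rogawski1990, §2.1] -/
theorem isFundamentalDomain_heisFundamentalDomain (hc : c * c = 1) (μ : Measure (adelicUnipotent F E c 3)) :
    IsFundamentalDomain (rationalUnipotent F E c 3) (heisFundamentalDomain F E c hc) μ :=
  IsFundamentalDomain.mk' (measurableSet_heisFundamentalDomain hc).nullMeasurableSet
    (existsUnique_smul_mem_heisFundamentalDomain hc)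

end Measure

end FundamentalDomain

end UnitaryGroup

end Literature.NumberTheory.Automorphic
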